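import Literature.MathematicalPhysics.KineticTheory.KickMatchedHardSphereGas
import Literature.Uncategorized.KickMatchedMeasurable
import HarnessLib

/-!
# Stub W1 `stub_kickMatchedMeasurable` of the crux line `stein-lindeberg-kick-swap`
(crux `InformationPercolationEngine.PercolationClosesChaos`, stmt-AtomisticToContinuum-13914)

Joint measurability, in (initial datum, dice), of the time-`t` map of the kick-matched hard-sphere gas
`Z*` of `Literature.MathematicalPhysics.KineticTheory.KickMatchedHardSphereGas`:
`(z, u) ↦ kmFlow σ N u z t = Driven.flow geo (hsDiameter σ N) (kmRule σ N) u z t`, for every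
`0 < σ < 1/2`, `N`, `t` — statement `KickMatchedMeasurable` (clause (i) of the construction statement
`KickMatchedStationary` of the line; tree copy `Literature.Uncategorized.KickMatchedMeasurable`, relocated there by
the gate), proved as `stub_kickMatchedMeasurable`.

The proof is the library's `Driven.measurable_flow` (measurability of the noise-driven collision
recursion for a hard-sphere regular, measurable geometry and a jointly measurable pair rule), fed with
`Torus.isHardSphereRegular_geometry` (`hsDiameter σ N ≤ σ < 1/2`), `Torus.isMeasurable_geometry` and the
joint measurability of the rule `kmRule σ N i j y d = kickAt σ N i j (kmNormal σ N i j y d) y`: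
* `measurable_lambert_lift`: Lambert's lift `a ↦ Lambert.lift (ω a) (q a)` of measurable arguments is
  measurable (the polar frame `Lambert.e₁/e₂` is piecewise given by measurable coordinate formulas);
* `measurable_kickAt`: re-placing the partner and reflecting specularly is jointly measurable in
  `(y, ω)` (`measurable_update'`, `Geometry.IsMeasurable.measurable_collidePair`);
* `measurableSet_isAdmissible`: the admissible set is measurable (`measurableSet_hardSphereDomain`);
* `measurable_dite_find`: a `dite` over `∃ n, P n x` selecting the first index `Nat.find` among
  measurable predicates, with measurable branches, is measurable (`Measurable.find` on the subtype);
* `measurable_kmNormal`, `measurableRule_kmRule`: the rejection sampler and the rule are measurable.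
-/

noncomputable section

open scoped BigOperators ENNReal Topology RealInnerProductSpace
open MeasureTheory Set Filter
open Literature.Analysis.FluidPDE

namespace Summit.AtomisticToContinuum.HydrodynamicLimit.Theorems.SteinLindebergKickSwap

open Literature.MathematicalPhysics.KineticTheory
open Literature.MathematicalPhysics.KineticTheory.KickMatchedHardSphereGas
open Literature.Uncategorized

/-! ## The statement

`KickMatchedMeasurable` (verbatim the line skeleton's W1 statement,
`∀ σ, 0 < σ → σ < 1 / 2 → ∀ N t, Measurable fun q : Cfg N × (ℕ → Die) => kmFlow σ N q.2 q.1 t`) was relocated by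
the gate to `Literature.Uncategorized.KickMatchedMeasurable` (p76493); it is imported and opened here, so that
`stub_kickMatchedMeasurable : KickMatchedMeasurable` below closes it (and, by `rfl` unfolding, the skeleton's copy). -/

/-! ## Measurability of Lambert's lift -/

section Lambert

/-- Coordinates of `ℝ³` are measurable. [folklore] -/
private theorem measurable_apply_v3 (k : Fin 3) : Measurable fun ω : V3 => ω k :=
  (measurable_pi_apply k).comp (WithLp.measurable_ofLp 2 _)

/-- Coordinates of `ℝ²` are measurable. [folklore] -/
private theorem measurable_apply_e2 (k : Fin 2) : Measurable fun q : EuclideanSpace ℝ (Fin 2) => q k :=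
  (measurable_pi_apply k).comp (WithLp.measurable_ofLp 2 _)

/-- A vector of `ℝ³` with measurable coordinate functions is measurable. [folklore] -/
private theorem measurable_vec3 {α : Type*} [MeasurableSpace α] {f g h : α → ℝ} (hf : Measurable f)
    (hg : Measurable g) (hh : Measurable h) : Measurable fun a => (!₂[f a, g a, h a] : V3) := by
  refine (WithLp.measurable_toLp 2 _).comp (measurable_pi_lambda _ fun k => ?_)
  fin_cases k
  · simpa using hf
  · simpa using hg
  · simpa using hh

/-- The cylindrical radius `Lambert.rho` is measurable. [folklore] -/
theorem measurable_lambert_rho : Measurable Lambert.rho := by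
  unfold Lambert.rho
  exact (((measurable_apply_v3 0).pow_const 2).add ((measurable_apply_v3 1).pow_const 2)).sqrt

/-- The first frame leg `Lambert.e₁` (piecewise coordinate formula) is measurable. [folklore] -/
theorem measurable_lambert_e₁ : Measurable Lambert.e₁ := by
  unfold Lambert.e₁
  refine Measurable.ite (measurableSet_eq_fun measurable_lambert_rho measurable_const) ?_ ?_
  · exact measurable_const
  · exact measurable_vec3 ((measurable_apply_v3 1).neg.div measurable_lambert_rho)
      ((measurable_apply_v3 0).div measurable_lambert_rho) measurable_const

/-- The second frame leg `Lambert.e₂` (piecewise coordinate formula) is measurable. [folklore] -/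
theorem measurable_lambert_e₂ : Measurable Lambert.e₂ := by
  unfold Lambert.e₂
  refine Measurable.ite (measurableSet_eq_fun measurable_lambert_rho measurable_const) ?_ ?_
  · exact measurable_vec3 measurable_const (measurable_apply_v3 2) measurable_const
  · exact measurable_vec3 (((measurable_apply_v3 0).mul (measurable_apply_v3 2)).neg.div measurable_lambert_rho)
      (((measurable_apply_v3 1).mul (measurable_apply_v3 2)).neg.div measurable_lambert_rho)
      measurable_lambert_rho

/-- **Lambert's lift of measurable arguments is measurable**: `a ↦ Lambert.lift (ω a) (q a)`
(`lift ω q = q₀ e₁ ω + q₁ e₂ ω + √(1 − |q|²) ω`). [folklore] -/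
theorem measurable_lambert_lift {α : Type*} [MeasurableSpace α] {ω : α → V3}
    {q : α → EuclideanSpace ℝ (Fin 2)} (hω : Measurable ω) (hq : Measurable q) :
    Measurable fun a => Lambert.lift (ω a) (q a) := by
  unfold Lambert.lift Lambert.embed
  exact ((((measurable_apply_e2 0).comp hq).smul (measurable_lambert_e₁.comp hω)).add
    (((measurable_apply_e2 1).comp hq).smul (measurable_lambert_e₂.comp hω))).add
    ((measurable_const.sub (hq.norm.pow_const 2)).sqrt.smul hω)

end Lambert

/-! ## A measurable first-hit selection -/

/-- **Measurable rejection sampling.** If the predicates `P n` are measurable and the branches `f n`, `g`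
are measurable, then `x ↦ if h : ∃ n, P n x then f (Nat.find h) x else g x` is measurable (for ANY
decidability instances): on the measurable set `{∃ n, P n x}` it is `Measurable.find`, off it `g`. [folklore] -/
theorem measurable_dite_find {α β : Type*} [MeasurableSpace α] [MeasurableSpace β]
    {P : ℕ → α → Prop} {f : ℕ → α → β} {g : α → β}
    {instP : ∀ x, DecidablePred fun n => P n x} {instE : ∀ x, Decidable (∃ n, P n x)}
    (hf : ∀ n, Measurable (f n)) (hg : Measurable g) (hP : ∀ n, MeasurableSet {x | P n x}) :
    Measurable fun x => if h : ∃ n, P n x then f (Nat.find h) x else g x := by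
  have hS : MeasurableSet {x | ∃ n, P n x} := by
    simpa only [setOf_exists] using MeasurableSet.iUnion hP
  refine measurable_of_restrict_of_restrict_compl hS ?_ ?_
  · have h2 : ∀ y : {x | ∃ n, P n x}, ∃ n, P n (y : α) := fun y => y.2
    have hm : Measurable fun y : {x | ∃ n, P n x} => f (Nat.find (h2 y)) y :=
      Measurable.find (p := fun n (y : {x | ∃ n, P n x}) => P n (y : α))
        (fun n => (hf n).comp measurable_subtype_coe) (fun n => measurable_subtype_coe (hP n)) h2
    have e : ({x | ∃ n, P n x}.restrict fun x => if h : ∃ n, P n x then f (Nat.find h) x else g x) =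
        fun y => f (Nat.find (h2 y)) y := by
      funext y
      exact dif_pos (h2 y)
    rw [e]
    exact hm
  · have e : ({x | ∃ n, P n x}ᶜ.restrict fun x => if h : ∃ n, P n x then f (Nat.find h) x else g x) =
        fun y : ({x | ∃ n, P n x}ᶜ : Set α) => g y := by
      funext y
      exact dif_neg y.2
    rw [e]
    exact hg.comp measurable_subtype_coe

/-! ## Measurability of the kick-matched rule -/

variable (σ : ℝ) (N : ℕ) (i j : Fin (N + 1))

/-- **Re-placing the partner and reflecting specularly is jointly measurable** in `(y, ω)`. [folklore] -/
theorem measurable_kickAt : Measurable fun p : Cfg N × V3 => kickAt σ N i j p.2 p.1 := by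
  have hG : geo.IsMeasurable := Torus.isMeasurable_geometry
  have hpos : Measurable fun p : Cfg N × V3 => geo.translate (p.1 i).1 (-(hsDiameter σ N • p.2)) :=
    hG.measurable_translate.comp (((Geometry.IsMeasurable.measurable_pos i).comp measurable_fst).prodMk
      (measurable_snd.const_smul (hsDiameter σ N)).neg)
  have hupd : Measurable fun p : Cfg N × V3 =>
      Function.update p.1 j (geo.translate (p.1 i).1 (-(hsDiameter σ N • p.2)), (p.1 j).2) :=
    measurable_update'.comp (measurable_fst.prodMk
      (hpos.prodMk ((Geometry.IsMeasurable.measurable_vel j).comp measurable_fst)))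
  exact (hG.measurable_collidePair i j).comp hupd

/-- **The admissible set is measurable** (as a subset of `Cfg N × V3`). [folklore] -/
theorem measurableSet_isAdmissible : MeasurableSet {p : Cfg N × V3 | IsAdmissible σ N i j p.2 p.1} := by
  have h1 : MeasurableSet {p : Cfg N × V3 | ‖p.2‖ = 1} :=
    measurableSet_eq_fun measurable_snd.norm measurable_const
  have h2 : MeasurableSet {p : Cfg N × V3 | 0 < ⟪(p.1 j).2 - (p.1 i).2, p.2⟫} :=
    measurableSet_lt measurable_const ((((Geometry.IsMeasurable.measurable_vel j).sub
      (Geometry.IsMeasurable.measurable_vel i)).comp measurable_fst).inner measurable_snd)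
  have h3 : MeasurableSet {p : Cfg N × V3 |
      kickAt σ N i j p.2 p.1 ∈ hardSphereDomain geo (N + 1) (hsDiameter σ N)} :=
    (measurableSet_hardSphereDomain geo Torus.measurable_geometry_sepVec (N + 1) (hsDiameter σ N)).preimage
      (measurable_kickAt σ N i j)
  exact h1.inter (h2.inter h3)

/-- The normalised relative velocity `a(y) = |w − v|⁻¹ (w − v)` of the pair is measurable. [folklore] -/
theorem measurable_relDir : Measurable fun y : Cfg N => ‖(y j).2 - (y i).2‖⁻¹ • ((y j).2 - (y i).2) :=
  have h := (Geometry.IsMeasurable.measurable_vel (N := N + 1) (d := Fin 3) (X := T3) j).sub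
    (Geometry.IsMeasurable.measurable_vel i)
  h.norm.inv.smul h

/-- **The rejection sampler `kmNormal` is jointly measurable** in `(y, d)`. [folklore] -/
theorem measurable_kmNormal : Measurable fun q : Cfg N × Die => kmNormal σ N i j q.1 q.2 := by
  have ha : Measurable fun q : Cfg N × Die => ‖(q.1 j).2 - (q.1 i).2‖⁻¹ • ((q.1 j).2 - (q.1 i).2) :=
    (measurable_relDir N i j).comp measurable_fst
  have hd : ∀ n, Measurable fun q : Cfg N × Die => q.2 n := fun n =>
    (measurable_pi_apply n).comp measurable_snd
  have hf : ∀ n, Measurable fun q : Cfg N × Die =>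
      Lambert.lift (‖(q.1 j).2 - (q.1 i).2‖⁻¹ • ((q.1 j).2 - (q.1 i).2)) (q.2 n) := fun n =>
    measurable_lambert_lift ha (hd n)
  have hg : Measurable fun q : Cfg N × Die => (hsDiameter σ N)⁻¹ • geo.sepVec (q.1 i).1 (q.1 j).1 :=
    ((Torus.isMeasurable_geometry.measurable_sepVec_config i j).comp measurable_fst).const_smul
      (hsDiameter σ N)⁻¹
  have hP : ∀ n, MeasurableSet {q : Cfg N × Die | ‖q.2 n‖ ≤ 1 ∧ IsAdmissible σ N i j
      (Lambert.lift (‖(q.1 j).2 - (q.1 i).2‖⁻¹ • ((q.1 j).2 - (q.1 i).2)) (q.2 n)) q.1} := by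
    intro n
    have h1 : MeasurableSet {q : Cfg N × Die | ‖q.2 n‖ ≤ 1} :=
      measurableSet_le (hd n).norm measurable_const
    have h2 : MeasurableSet {q : Cfg N × Die | IsAdmissible σ N i j
        (Lambert.lift (‖(q.1 j).2 - (q.1 i).2‖⁻¹ • ((q.1 j).2 - (q.1 i).2)) (q.2 n)) q.1} := by
      have h := (measurableSet_isAdmissible σ N i j).preimage (measurable_fst.prodMk (hf n))
      exact h
    exact h1.inter h2
  -- the implicit data of `measurable_dite_find` are given explicitly, so that matching the unfolded
  -- `kmNormal` against the lemma's conclusion is first-order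
  exact measurable_dite_find
    (P := fun n (q : Cfg N × Die) => ‖q.2 n‖ ≤ 1 ∧
      IsAdmissible σ N i j (Lambert.lift (‖(q.1 j).2 - (q.1 i).2‖⁻¹ • ((q.1 j).2 - (q.1 i).2)) (q.2 n)) q.1)
    (f := fun n (q : Cfg N × Die) =>
      Lambert.lift (‖(q.1 j).2 - (q.1 i).2‖⁻¹ • ((q.1 j).2 - (q.1 i).2)) (q.2 n))
    (g := fun q : Cfg N × Die => (hsDiameter σ N)⁻¹ • geo.sepVec (q.1 i).1 (q.1 j).1) hf hg hP

/-- **The kick-matched pair rule is jointly measurable** (`Driven.MeasurableRule`). [folklore] -/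
theorem measurableRule_kmRule : Driven.MeasurableRule (kmRule σ N) := by
  intro i j
  have h := (measurable_kickAt σ N i j).comp (measurable_fst.prodMk (measurable_kmNormal σ N i j))
  exact h

/-! ## The stub -/

/-- **W1 · `stub_kickMatchedMeasurable`**: the time-`t` map `(z, u) ↦ kmFlow σ N u z t` of the kick-matched
gas is jointly measurable in (datum, dice) for every `0 < σ < 1/2`, `N`, `t` — `Driven.measurable_flow` for
the hard-sphere regular (`hsDiameter σ N ≤ σ < 1/2`) measurable torus geometry and the measurable rule
`kmRule σ N`. [folklore] -/
theorem stub_kickMatchedMeasurable : KickMatchedMeasurable := by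
  intro σ hσ hσ2 N t
  have hε : hsDiameter σ N < 2⁻¹ := (hsDiameter_le hσ.le N).trans_lt (hσ2.trans_eq (one_div 2))
  exact Driven.measurable_flow (Torus.isHardSphereRegular_geometry hε) Torus.isMeasurable_geometry
    (measurableRule_kmRule σ N) t

end Summit.AtomisticToContinuum.HydrodynamicLimit.Theorems.SteinLindebergKickSwap

end
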